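import Literature.Geometry.Lorentzian.HintzGluedEMRIData
import Literature.Geometry.Lorentzian.InitialDataLocality
import HarnessLib

/-!
# Obstruction-free gluing of almost flat vacuum data on annuli (Mao–Oh–Tao 2023)

Y. Mao, S.-J. Oh, Z. Tao, *Initial data gluing in the asymptotically flat regime via solution operators with prescribed
support properties*, arXiv:2308.13031 [MaoOhTao2023].

* §1 the η-averaged linear charges `E, P, C, J` of a pair of coefficient fields `(g, k)` on `ℝ³` (loc. cit. §1.2,
  (1.3)–(1.7)), written as volume integrals against the radial weight `η_r(|x|) = r⁻¹ η(|x|/r)` (the coarea form of the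
  sphere averages `∫ η_r(r′) Q[∂B_{r′}] dr′`); the `C² × C¹` sup-deviation predicate `DevLE` and the localised vacuum
  predicate `InitialDataSet.VacOn` used to state the theorem over the tree's `InitialDataSet (𝓡 3) E3`;
* §2 the named fact `MaoOhTao.ObstructionFreeAnnularGluing` = Thm 1.7 with Rem 1.9 (persistence of regularity), in the
  special case `s = 2`, `Γ = 2`, with sup-norm smallness (which dominates the printed `H² × H¹` smallness on the bounded
  annuli, constants absorbed in `μ_o`), in/out data given as smooth data on all of `ℝ³` of which only the restrictions to the
  annuli `A_1 = {1 < |x| < 2}`, `A_32 = {32 < |x| < 64}` enter, and with the glued solution on `B_64 ∖ B̄_1` extended by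
  the in-datum inside `B_2` and by the out-datum outside `B_32` (they agree on the open annuli `A_1`, `A_32`) to one smooth
  datum on `ℝ³`.

Design: the charges are the LINEARISED ones of loc. cit. (no `1/16π`); the sign convention of `k` is immaterial (the
hypotheses are invariant under `(k_in, k_out) ↦ (−k_in, −k_out)`).  Deliberately NOT here: Thm 1.3 (gluing up to the
10-dimensional obstruction), Thm 1.10 (the asymptotically flat corollary), the Lipschitz dependence of Rem 1.9, the output
bound `‖(g − δ, k)‖² < C_o ΔE`, general `s > 3/2` and `Γ > 1`.

Mathlib: `fderiv`, `iteratedFDeriv`, Bochner integral on `EuclideanSpace ℝ (Fin 3)`; the tree's `InitialDataSet`,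
`coordH/coordK` (`HintzGluedEMRIData.lean`), `hamiltonianConstraintFn/momentumConstraintFn` (`InitialData.lean`).
-/

noncomputable section

namespace Literature.Geometry.Lorentzian

open scoped _root_.Manifold _root_.ContDiff BigOperators
open _root_.MeasureTheory

namespace MaoOhTao

/-! ## §1 Averaged charges, deviation, localised constraints -/

/-- The standard basis vector `e_i` of `ℝ³`. [folklore] -/
def e (i : Fin 3) : E3 := EuclideanSpace.single i 1

/-- The coordinate partial derivative `∂_l f (x)` of a real function on `ℝ³` (Fréchet derivative evaluated on `e_l`; junk `0`
where `f` is not differentiable). [folklore] -/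
def pd (l : Fin 3) (f : E3 → ℝ) (x : E3) : ℝ := fderiv ℝ f x (e l)

/-- The component `g_{ij} = g(e_i, e_j)` of a field of bilinear forms on `ℝ³`, as a real function. [folklore] -/
def cmp (g : E3 → E3 →L[ℝ] E3 →L[ℝ] ℝ) (i j : Fin 3) : E3 → ℝ := fun x ↦ g x (e i) (e j)

/-- The Euclidean trace `tr_δ k = Σ_i k_{ii}`. [cite: MaoOhTao2023, §1.1] -/
def trδ (k : E3 → E3 →L[ℝ] E3 →L[ℝ] ℝ) (x : E3) : ℝ := ∑ i, cmp k i i x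

/-- The radial weight `η_r(|x|) = r⁻¹ η(|x|/r)` of the dyadic annulus `A_r = {r < |x| < 2r}`. [cite: MaoOhTao2023, §1.2 (1.7)] -/
def wt (η : ℝ → ℝ) (r : ℝ) (x : E3) : ℝ := r⁻¹ * η (‖x‖ / r)

/-- The infinitesimal rotation `Y_l = e_l × x` about the `x^l`-axis, as a component vector. [cite: MaoOhTao2023, §1.1] -/
def rotGen (l : Fin 3) (x : E3) : Fin 3 → ℝ :=
  ![e l 1 * x 2 - e l 2 * x 1, e l 2 * x 0 - e l 0 * x 2, e l 0 * x 1 - e l 1 * x 0]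

/-- **Averaged linear energy** `E[(g,k); A_r] = ½ ∫ η_r(|x|) Σ_{i,j} (∂_i g_{ij} − ∂_j g_{ii})(x) x^j/|x| dx`
(Mao–Oh–Tao (1.3) averaged as in (1.7), coarea form). [cite: MaoOhTao2023, §1.2 (1.3), (1.7)] -/
def avgE (η : ℝ → ℝ) (r : ℝ) (g : E3 → E3 →L[ℝ] E3 →L[ℝ] ℝ) : ℝ :=
  (1 / 2) * ∫ x : E3, wt η r x * ∑ i, ∑ j, (pd i (cmp g i j) x - pd j (cmp g i i) x) * (x j / ‖x‖)

/-- **Averaged linear momentum** `P_i[(g,k); A_r] = ∫ η_r(|x|) Σ_j (k_{ij} − δ_{ij} tr_δ k)(x) x^j/|x| dx`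
(Mao–Oh–Tao (1.4), (1.7)). [cite: MaoOhTao2023, §1.2 (1.4), (1.7)] -/
def avgP (η : ℝ → ℝ) (r : ℝ) (k : E3 → E3 →L[ℝ] E3 →L[ℝ] ℝ) (i : Fin 3) : ℝ :=
  ∫ x : E3, wt η r x * ∑ j, (cmp k i j x - (if i = j then trδ k x else 0)) * (x j / ‖x‖)

/-- **Averaged centre of mass** `C_l[(g,k); A_r] = ½ ∫ η_r(|x|) Σ_{i,j} (x_l ∂_i g_{ij} − x_l ∂_j g_{ii} − δ_{il}(g_{ij} − δ_{ij})
+ δ_{jl}(g_{ii} − δ_{ii}))(x) x^j/|x| dx` (Mao–Oh–Tao (1.5), (1.7)). [cite: MaoOhTao2023, §1.2 (1.5), (1.7)] -/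
def avgC (η : ℝ → ℝ) (r : ℝ) (g : E3 → E3 →L[ℝ] E3 →L[ℝ] ℝ) (l : Fin 3) : ℝ :=
  (1 / 2) * ∫ x : E3, wt η r x * ∑ i, ∑ j,
    (x l * pd i (cmp g i j) x - x l * pd j (cmp g i i) x
      - (if i = l then cmp g i j x - (if i = j then 1 else 0) else 0)
      + (if j = l then cmp g i i x - 1 else 0)) * (x j / ‖x‖)

/-- **Averaged angular momentum** `J_l[(g,k); A_r] = ∫ η_r(|x|) Σ_{i,j} (k_{ij} − δ_{ij} tr_δ k)(x) Y_l^i(x) x^j/|x| dx`,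
`Y_l = e_l × x` (Mao–Oh–Tao (1.6), (1.7)). [cite: MaoOhTao2023, §1.2 (1.6), (1.7)] -/
def avgJ (η : ℝ → ℝ) (r : ℝ) (k : E3 → E3 →L[ℝ] E3 →L[ℝ] ℝ) (l : Fin 3) : ℝ :=
  ∫ x : E3, wt η r x * ∑ i, ∑ j, (cmp k i j x - (if i = j then trδ k x else 0)) * rotGen l x i * (x j / ‖x‖)

/-- An admissible radial bump: `η ∈ C^∞(ℝ)`, `supp η ⊆ [1, 2]`, `∫ η = 1` (Mao–Oh–Tao §1.2: "Fix `η ∈ C_c^∞(0, ∞)` such that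
`supp η ⊆ (1, 2)`, `∫ η = 1`"). [cite: MaoOhTao2023, §1.2] -/
def IsBump (η : ℝ → ℝ) : Prop :=
  ContDiff ℝ ∞ η ∧ (∀ s, s ≤ 1 → η s = 0) ∧ (∀ s, 2 ≤ s → η s = 0) ∧ ∫ s, η s = 1

set_option synthInstance.maxHeartbeats 120000 in
-- the operator norm on `E3 [×m]→L[ℝ] (E3 →L[ℝ] E3 →L[ℝ] ℝ)` needs a longer instance search than the default budget
/-- **`C² × C¹` sup-deviation from flat data**: `|∂^m (g − δ)(x)| ≤ s` for `m ≤ 2` and `|∂^m k(x)| ≤ s` for `m ≤ 1` at every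
point of the closed annulus `{a ≤ |x| ≤ b}` (it dominates the `H² × H¹(A)` norm of Mao–Oh–Tao Thm 1.7 on a bounded annulus).
[folklore] -/
def DevLE (g k : E3 → E3 →L[ℝ] E3 →L[ℝ] ℝ) (a b s : ℝ) : Prop :=
  ∀ x : E3, a ≤ ‖x‖ → ‖x‖ ≤ b →
    (∀ m : ℕ, m ≤ 2 → ‖iteratedFDeriv ℝ m (fun y ↦ g y - (innerSL ℝ : E3 →L[ℝ] E3 →L[ℝ] ℝ)) x‖ ≤ s) ∧
    (∀ m : ℕ, m ≤ 1 → ‖iteratedFDeriv ℝ m k x‖ ≤ s)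

end MaoOhTao

namespace InitialDataSet

/-- A datum on `ℝ³` **solves the vacuum constraints on the open annulus** `{a < |x| < b}` (pointwise Hamiltonian and momentum
constraints, under the standing Levi-Civita hypothesis of `InitialData`). [folklore] -/
def VacOn (D : InitialDataSet (𝓡 3) E3) (a b : ℝ) : Prop :=
  ∀ [D.metric.HasLeviCivita] (y : E3), a < ‖y‖ → ‖y‖ < b → D.hamiltonianConstraintFn y = 0 ∧ D.momentumConstraintFn y = 0

/-- Two data on `ℝ³` **have the same sections at `y`** (metric and second fundamental form). [folklore] -/
def SameAt (D D' : InitialDataSet (𝓡 3) E3) (y : E3) : Prop :=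
  D.h.inner y = D'.h.inner y ∧ D.k y = D'.k y

end InitialDataSet

namespace MaoOhTao

open InitialDataSet

/-! ## §2 Theorem 1.7 (with Remark 1.9) -/

/-- **Obstruction-free gluing for almost flat data on annuli** (Mao–Oh–Tao, arXiv:2308.13031, Thm 1.7 with Rem 1.9; here
`s = 2`, `Γ = 2`).  As printed: given `s > 3/2`, `Γ > 1` there are `ε_o, μ_o, C_o > 0` such that for
`(g_in,k_in) ∈ H^s × H^{s−1}(A_1)`, `(g_out,k_out) ∈ H^s × H^{s−1}(A_32)` solving the vacuum constraints, with
`ΔQ = Q[(g_out,k_out); A_32] − Q[(g_in,k_in); A_1]` the difference of the η-averaged charges `(E, P, C, J)`, the conditions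
`ΔE > |ΔP|`, `ΔE/√(ΔE² − |ΔP|²) < Γ`, `ΔE < ε_o²`, `|ΔC| + |ΔJ| < μ_o ΔE`,
`‖(g_in − δ, k_in)‖² + ‖(g_out − δ, k_out)‖² < μ_o ΔE` yield `(g,k) ∈ H^s × H^{s−1}(B_64 ∖ B̄_1)` solving the constraints with
`(g,k) = (g_in,k_in)` on `A_1` and `= (g_out,k_out)` on `A_32`; Rem 1.9 (persistence of regularity): smooth in/out data give a
smooth `(g,k)`.  This rendering: in/out are smooth data on `ℝ³` solving the constraints on the open annuli `A_1`, `A_32`, the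
smallness is the `C² × C¹` sup-deviation on the closed annuli, and the conclusion is one smooth datum on `ℝ³` solving the
constraints on `{1 < |x| < 64}` which IS the in-datum on `B_2` and the out-datum outside `B_32`.
-- TODO(general form): `s > 3/2`, `Γ > 1`, `H^s × H^{s−1}` smallness, the bound `‖(g − δ, k)‖² < C_o ΔE`, Lipschitz dependence.
[cite: MaoOhTao2023, Thm 1.7, Rem 1.9] -/
def ObstructionFreeAnnularGluing : Prop :=
  ∀ η : ℝ → ℝ, IsBump η →
    ∃ εo μo : ℝ, 0 < εo ∧ 0 < μo ∧
      ∀ (Din Dout : InitialDataSet (𝓡 3) E3) (sIn sOut : ℝ),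
        Din.VacOn 1 2 → Dout.VacOn 32 64 →
        DevLE Din.coordH Din.coordK 1 2 sIn → DevLE Dout.coordH Dout.coordK 32 64 sOut →
        letI ΔE := avgE η 32 Dout.coordH - avgE η 1 Din.coordH
        letI ΔP := fun i ↦ avgP η 32 Dout.coordK i - avgP η 1 Din.coordK i
        letI ΔC := fun i ↦ avgC η 32 Dout.coordH i - avgC η 1 Din.coordH i
        letI ΔJ := fun i ↦ avgJ η 32 Dout.coordK i - avgJ η 1 Din.coordK i
        Real.sqrt (∑ i, ΔP i ^ 2) < ΔE →
        ΔE < 2 * Real.sqrt (ΔE ^ 2 - ∑ i, ΔP i ^ 2) →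
        ΔE < εo ^ 2 →
        Real.sqrt (∑ i, ΔC i ^ 2) + Real.sqrt (∑ i, ΔJ i ^ 2) < μo * ΔE →
        sIn ^ 2 + sOut ^ 2 < μo * ΔE →
        ∃ D : InitialDataSet (𝓡 3) E3,
          D.VacOn 1 64 ∧ (∀ y : E3, ‖y‖ < 2 → D.SameAt Din y) ∧ (∀ y : E3, 32 < ‖y‖ → D.SameAt Dout y)

end MaoOhTao

end Literature.Geometry.Lorentzian

end
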